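import Mathlib
import HarnessLib
import Literature.Analysis.FluidPDE.SuitableWeak
import Literature.Analysis.FluidPDE.MildSolution
import Literature.Analysis.FluidPDE.AxisymmetricVorticityTransport
import Literature.Analysis.FluidPDE.AncientAxisymmetricTypeILiouville
import Summits.NavierStokesRegularity.NavierStokesRegularity.Theses.AngularGalerkinLadder

/-! # m = 0 EXCLUSION for the AGL window sequences, GIVEN the K3 birth stubs (planner g20, 2026-08-26)
(route `route-NavierStokesRegularity-AngularGalerkinLadder`, crux K3 = item stmt-NavierStokesRegularity-19961)

(v2: + the ANY-AXIS form via p468950 `not_typeI_rdss_profile_of_isAxisymmetric_conj`.)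
From the tree theorem `Literature.Analysis.FluidPDE.not_isAxisymmetric_typeI_rdss_profile` (p466949; KNSS 2009
Thm 5.3 corollary): K3's profile conjunction ∧ (every slice axisymmetric) is EMPTY. Along the registered-to-be K3
skeleton (`Cruxes/LimitTransfer/Lines/birth.lean` v2 5bab6dd61eb88943: `stub_local_compactness`,
`stub_structure_passes`; the two local notions are copied verbatim below so this file elaborates before the
turnkey lands), locally-uniform slice limits of x₃-AXISYMMETRIC rung profiles are axisymmetric, hence:
GIVEN THE TWO STUBS, NO WINDOW SEQUENCE HAS ALL ITS SLICES AXISYMMETRIC (`no_axisymmetric_window_sequence`).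
Reading: the singular windows the route transports must leave the m = 0 sector; m = 0 numerics can only ever be
MODEL evidence for K1's cheapest instances. WHAT THIS IS NOT: not NS — an implication from OPEN stubs; nothing
about NS_L rungs themselves is proved. -/

set_option linter.dupNamespace false

namespace Summit.NavierStokesRegularity.NavierStokesRegularity.Cruxes.LimitTransfer.AxisymExclusion

open scoped Topology
open Filter Set MeasureTheory
open Summit.NavierStokesRegularity.FluidComputer
open Literature.Analysis.FluidPDE (rotZ IsAxisymmetric)

local notation "ℝ³" => EuclideanSpace ℝ (Fin 3)

/-- (copy of the birth skeleton's notion) A WINDOW SEQUENCE: the hypothesis package of K3. -/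
def IsWindowSequence (C₀ cmin cmax δ : ℝ) (L : ℕ → ℕ) (ε c : ℕ → ℝ) (R : ℕ → (ℝ³ ≃ₗᵢ[ℝ] ℝ³))
    (u : ℕ → ℝ → ℝ³ → ℝ³) (p : ℕ → ℝ → ℝ³ → ℝ) (d : ℕ → ℝ → ℝ³ → ℝ³) : Prop :=
  1 < cmin ∧ 0 < δ ∧ Tendsto ε atTop (𝓝 0) ∧
    ∀ n, AngularLadder.IsWindowProfile (L n) C₀ cmin cmax δ (ε n) (c n) (R n) (u n) (p n) (d n)

/-- (copy of the birth skeleton's notion) A LADDER LIMIT along the subsequence `φ`. -/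
def IsLadderLimit (C₀ : ℝ) (c : ℕ → ℝ) (R : ℕ → (ℝ³ ≃ₗᵢ[ℝ] ℝ³)) (u : ℕ → ℝ → ℝ³ → ℝ³)
    (φ : ℕ → ℕ) (c' : ℝ) (R' : ℝ³ ≃ₗᵢ[ℝ] ℝ³) (v : ℝ → ℝ³ → ℝ³) (q : ℝ → ℝ³ → ℝ) : Prop :=
  StrictMono φ ∧ Tendsto (fun n => c (φ n)) atTop (𝓝 c') ∧
    (∀ x, Tendsto (fun n => R (φ n) x) atTop (𝓝 (R' x))) ∧
    (∀ t < 0, TendstoLocallyUniformly (fun n => u (φ n) t) (v t) atTop) ∧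
    Literature.Analysis.FluidPDE.IsClassicalNSSolutionOn (Set.Iio 0) 1 0 v q ∧
    Literature.Analysis.FluidPDE.HasTypeIDecay C₀ v ∧
    ∀ t < 0, Literature.Analysis.FluidPDE.IsBoundedOn (Set.Iic t) q

/-- Rotations about the axis are continuous (they are the tree's linear isometry equivalences `rotZLIE θ`). -/
theorem continuous_rotZ (θ : ℝ) : Continuous (rotZ θ) :=
  (Literature.Analysis.FluidPDE.rotZLIE θ).continuous.congr
    fun x => Literature.Analysis.FluidPDE.rotZLIE_apply θ x

/-- Pointwise limits of axisymmetric fields are axisymmetric. -/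
theorem isAxisymmetric_of_tendsto {u : ℕ → ℝ³ → ℝ³} {v : ℝ³ → ℝ³}
    (h : ∀ x, Tendsto (fun n => u n x) atTop (𝓝 (v x))) (hax : ∀ n, IsAxisymmetric (u n)) :
    IsAxisymmetric v := by
  intro θ x
  have h1 : Tendsto (fun n => u n (rotZ θ x)) atTop (𝓝 (v (rotZ θ x))) := h _
  have h2 : Tendsto (fun n => rotZ θ (u n x)) atTop (𝓝 (rotZ θ (v x))) :=
    ((continuous_rotZ θ).tendsto _).comp (h x)
  have h3 : (fun n => u n (rotZ θ x)) = fun n => rotZ θ (u n x) := funext fun n => hax n θ x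
  rw [h3] at h1
  exact tendsto_nhds_unique h1 h2

/-- Slices of a ladder limit of slice-axisymmetric rung profiles are axisymmetric. -/
theorem isAxisymmetric_of_isLadderLimit {C₀ : ℝ} {c : ℕ → ℝ} {R : ℕ → (ℝ³ ≃ₗᵢ[ℝ] ℝ³)}
    {u : ℕ → ℝ → ℝ³ → ℝ³} {φ : ℕ → ℕ} {c' : ℝ} {R' : ℝ³ ≃ₗᵢ[ℝ] ℝ³} {v : ℝ → ℝ³ → ℝ³}
    {q : ℝ → ℝ³ → ℝ} (hlim : IsLadderLimit C₀ c R u φ c' R' v q)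
    (hax : ∀ n, ∀ t < 0, IsAxisymmetric (u n t)) : ∀ t < 0, IsAxisymmetric (v t) :=
  fun t ht => isAxisymmetric_of_tendsto
    (fun x => ((hlim.2.2.2.1 t ht).tendstoLocallyUniformlyOn (s := Set.univ)).tendsto_at (Set.mem_univ x))
    fun n => hax (φ n) t ht

/-- **m = 0 exclusion given the K3 stubs.** If (stub 1) every window sequence has a ladder limit and
(stub 2) the profile structure passes to every such limit, then NO window sequence consists of rung profiles
all of whose slices are axisymmetric — the limit would be an axisymmetric nontrivial Type-I rDSS ancient mild
profile, which `not_isAxisymmetric_typeI_rdss_profile` (KNSS Thm 5.3) forbids. -/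
theorem no_axisymmetric_window_sequence
    (h1 : ∀ (C₀ cmin cmax δ : ℝ) (L : ℕ → ℕ) (ε c : ℕ → ℝ) (R : ℕ → (ℝ³ ≃ₗᵢ[ℝ] ℝ³))
      (u : ℕ → ℝ → ℝ³ → ℝ³) (p : ℕ → ℝ → ℝ³ → ℝ) (d : ℕ → ℝ → ℝ³ → ℝ³),
      IsWindowSequence C₀ cmin cmax δ L ε c R u p d →
        ∃ (φ : ℕ → ℕ) (c' : ℝ) (R' : ℝ³ ≃ₗᵢ[ℝ] ℝ³) (v : ℝ → ℝ³ → ℝ³) (q : ℝ → ℝ³ → ℝ),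
          IsLadderLimit C₀ c R u φ c' R' v q)
    (h2 : ∀ (C₀ cmin cmax δ : ℝ) (L : ℕ → ℕ) (ε c : ℕ → ℝ) (R : ℕ → (ℝ³ ≃ₗᵢ[ℝ] ℝ³))
      (u : ℕ → ℝ → ℝ³ → ℝ³) (p : ℕ → ℝ → ℝ³ → ℝ) (d : ℕ → ℝ → ℝ³ → ℝ³)
      (φ : ℕ → ℕ) (c' : ℝ) (R' : ℝ³ ≃ₗᵢ[ℝ] ℝ³) (v : ℝ → ℝ³ → ℝ³) (q : ℝ → ℝ³ → ℝ),
      IsWindowSequence C₀ cmin cmax δ L ε c R u p d → IsLadderLimit C₀ c R u φ c' R' v q →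
        1 < c' ∧ Literature.Analysis.FluidPDE.IsAncientMildSolution 1 v ∧
          (∀ t < 0, AEStronglyMeasurable (v t) volume) ∧ Literature.Analysis.FluidPDE.IsRotatedDSS c' R' v ∧
          (∃ C : ℝ, Literature.Analysis.FluidPDE.HasTypeIDecay C v) ∧ ¬ (∀ t < 0, v t =ᵐ[volume] 0)) :
    ∀ (C₀ cmin cmax δ : ℝ) (L : ℕ → ℕ) (ε c : ℕ → ℝ) (R : ℕ → (ℝ³ ≃ₗᵢ[ℝ] ℝ³))
      (u : ℕ → ℝ → ℝ³ → ℝ³) (p : ℕ → ℝ → ℝ³ → ℝ) (d : ℕ → ℝ → ℝ³ → ℝ³),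
      IsWindowSequence C₀ cmin cmax δ L ε c R u p d → ¬ (∀ n, ∀ t < 0, IsAxisymmetric (u n t)) := by
  intro C₀ cmin cmax δ L ε c R u p d hseq hax
  obtain ⟨φ, c', R', v, q, hlim⟩ := h1 C₀ cmin cmax δ L ε c R u p d hseq
  obtain ⟨hc', hmild, hmeas, hdss, hdec, hnz⟩ := h2 C₀ cmin cmax δ L ε c R u p d φ c' R' v q hseq hlim
  exact Literature.Analysis.FluidPDE.not_isAxisymmetric_typeI_rdss_profile
    ⟨c', R', v, hc', hmild, hmeas, hdss, hdec, hnz, isAxisymmetric_of_isLadderLimit hlim hax⟩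

/-- The same exclusion read on the route's deciding chain: from K1 and K2 the `closes` proof selects a window
sequence (levels `L n ≥ max L₀ n`); given the stubs, that sequence is NOT slice-axisymmetric. -/
theorem selected_windows_not_axisymmetric
    (h1 : ∀ (C₀ cmin cmax δ : ℝ) (L : ℕ → ℕ) (ε c : ℕ → ℝ) (R : ℕ → (ℝ³ ≃ₗᵢ[ℝ] ℝ³))
      (u : ℕ → ℝ → ℝ³ → ℝ³) (p : ℕ → ℝ → ℝ³ → ℝ) (d : ℕ → ℝ → ℝ³ → ℝ³),
      IsWindowSequence C₀ cmin cmax δ L ε c R u p d →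
        ∃ (φ : ℕ → ℕ) (c' : ℝ) (R' : ℝ³ ≃ₗᵢ[ℝ] ℝ³) (v : ℝ → ℝ³ → ℝ³) (q : ℝ → ℝ³ → ℝ),
          IsLadderLimit C₀ c R u φ c' R' v q)
    (h2 : ∀ (C₀ cmin cmax δ : ℝ) (L : ℕ → ℕ) (ε c : ℕ → ℝ) (R : ℕ → (ℝ³ ≃ₗᵢ[ℝ] ℝ³))
      (u : ℕ → ℝ → ℝ³ → ℝ³) (p : ℕ → ℝ → ℝ³ → ℝ) (d : ℕ → ℝ → ℝ³ → ℝ³)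
      (φ : ℕ → ℕ) (c' : ℝ) (R' : ℝ³ ≃ₗᵢ[ℝ] ℝ³) (v : ℝ → ℝ³ → ℝ³) (q : ℝ → ℝ³ → ℝ),
      IsWindowSequence C₀ cmin cmax δ L ε c R u p d → IsLadderLimit C₀ c R u φ c' R' v q →
        1 < c' ∧ Literature.Analysis.FluidPDE.IsAncientMildSolution 1 v ∧
          (∀ t < 0, AEStronglyMeasurable (v t) volume) ∧ Literature.Analysis.FluidPDE.IsRotatedDSS c' R' v ∧
          (∃ C : ℝ, Literature.Analysis.FluidPDE.HasTypeIDecay C v) ∧ ¬ (∀ t < 0, v t =ᵐ[volume] 0))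
    (k1 : Summit.NavierStokesRegularity.NavierStokesRegularity.Theses.AngularGalerkinLadder.RungBlowupCofinal)
    (k2 : Summit.NavierStokesRegularity.NavierStokesRegularity.Theses.AngularGalerkinLadder.NoOverheating) :
    ∃ (C₀ cmin cmax δ : ℝ) (L : ℕ → ℕ) (ε c : ℕ → ℝ) (R : ℕ → (ℝ³ ≃ₗᵢ[ℝ] ℝ³))
      (u : ℕ → ℝ → ℝ³ → ℝ³) (p : ℕ → ℝ → ℝ³ → ℝ) (d : ℕ → ℝ → ℝ³ → ℝ³),
      IsWindowSequence C₀ cmin cmax δ L ε c R u p d ∧ Tendsto L atTop atTop ∧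
        ¬ (∀ n, ∀ t < 0, IsAxisymmetric (u n t)) := by
  obtain ⟨C₀, cmin, cmax, δ, L₀, ε, hcmin, hδ, hε, hwin⟩ := k2
  choose L hLge hLsing using fun n : ℕ => k1 (max L₀ n)
  choose c R u p d hW using fun n : ℕ => hwin (L n) (le_trans (le_max_left _ _) (hLge n)) (hLsing n)
  have hL : Tendsto L atTop atTop :=
    tendsto_atTop_mono (fun n => le_trans (le_max_right _ _) (hLge n)) tendsto_id
  have hseq : IsWindowSequence C₀ cmin cmax δ L (fun n => ε (L n)) c R u p d := ⟨hcmin, hδ, hε.comp hL, hW⟩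
  exact ⟨C₀, cmin, cmax, δ, L, fun n => ε (L n), c, R, u, p, d, hseq, hL,
    no_axisymmetric_window_sequence h1 h2 C₀ cmin cmax δ L _ c R u p d hseq⟩

/-! ### v2 — axisymmetry about ANY common fixed axis `A e₃` (tree p468950) -/

/-- Pointwise limits of fields axisymmetric about the common axis `A e₃` are axisymmetric about it. -/
theorem isAxisymmetric_conj_of_tendsto {u : ℕ → ℝ³ → ℝ³} {v : ℝ³ → ℝ³} (A : ℝ³ ≃ₗᵢ[ℝ] ℝ³)
    (h : ∀ x, Tendsto (fun n => u n x) atTop (𝓝 (v x)))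
    (hax : ∀ n, IsAxisymmetric (fun x => A.symm (u n (A x)))) :
    IsAxisymmetric (fun x => A.symm (v (A x))) :=
  isAxisymmetric_of_tendsto (u := fun n x => A.symm (u n (A x)))
    (fun x => (A.symm.continuous.tendsto _).comp (h (A x))) hax

/-- Slices of a ladder limit of rung profiles axisymmetric about a common fixed axis are axisymmetric about it. -/
theorem isAxisymmetric_conj_of_isLadderLimit {C₀ : ℝ} {c : ℕ → ℝ} {R : ℕ → (ℝ³ ≃ₗᵢ[ℝ] ℝ³)}
    {u : ℕ → ℝ → ℝ³ → ℝ³} {φ : ℕ → ℕ} {c' : ℝ} {R' : ℝ³ ≃ₗᵢ[ℝ] ℝ³} {v : ℝ → ℝ³ → ℝ³}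
    {q : ℝ → ℝ³ → ℝ} (hlim : IsLadderLimit C₀ c R u φ c' R' v q) (A : ℝ³ ≃ₗᵢ[ℝ] ℝ³)
    (hax : ∀ n, ∀ t < 0, IsAxisymmetric (fun x => A.symm (u n t (A x)))) :
    ∀ t < 0, IsAxisymmetric (fun x => A.symm (v t (A x))) :=
  fun t ht => isAxisymmetric_conj_of_tendsto A
    (fun x => ((hlim.2.2.2.1 t ht).tendstoLocallyUniformlyOn (s := Set.univ)).tendsto_at (Set.mem_univ x))
    fun n => hax (φ n) t ht

/-- **Any-axis m = 0 exclusion given the K3 stubs.** No window sequence consists of rung profiles all of whose slices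
are axisymmetric about one common fixed axis `A e₃` (`A` a linear isometry): the ladder limit would be a nontrivial
Type-I rDSS ancient mild profile axisymmetric about that axis, excluded by `not_typeI_rdss_profile_of_isAxisymmetric_conj`. -/
theorem no_conj_axisymmetric_window_sequence
    (h1 : ∀ (C₀ cmin cmax δ : ℝ) (L : ℕ → ℕ) (ε c : ℕ → ℝ) (R : ℕ → (ℝ³ ≃ₗᵢ[ℝ] ℝ³))
      (u : ℕ → ℝ → ℝ³ → ℝ³) (p : ℕ → ℝ → ℝ³ → ℝ) (d : ℕ → ℝ → ℝ³ → ℝ³),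
      IsWindowSequence C₀ cmin cmax δ L ε c R u p d →
        ∃ (φ : ℕ → ℕ) (c' : ℝ) (R' : ℝ³ ≃ₗᵢ[ℝ] ℝ³) (v : ℝ → ℝ³ → ℝ³) (q : ℝ → ℝ³ → ℝ),
          IsLadderLimit C₀ c R u φ c' R' v q)
    (h2 : ∀ (C₀ cmin cmax δ : ℝ) (L : ℕ → ℕ) (ε c : ℕ → ℝ) (R : ℕ → (ℝ³ ≃ₗᵢ[ℝ] ℝ³))
      (u : ℕ → ℝ → ℝ³ → ℝ³) (p : ℕ → ℝ → ℝ³ → ℝ) (d : ℕ → ℝ → ℝ³ → ℝ³)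
      (φ : ℕ → ℕ) (c' : ℝ) (R' : ℝ³ ≃ₗᵢ[ℝ] ℝ³) (v : ℝ → ℝ³ → ℝ³) (q : ℝ → ℝ³ → ℝ),
      IsWindowSequence C₀ cmin cmax δ L ε c R u p d → IsLadderLimit C₀ c R u φ c' R' v q →
        1 < c' ∧ Literature.Analysis.FluidPDE.IsAncientMildSolution 1 v ∧
          (∀ t < 0, AEStronglyMeasurable (v t) volume) ∧ Literature.Analysis.FluidPDE.IsRotatedDSS c' R' v ∧
          (∃ C : ℝ, Literature.Analysis.FluidPDE.HasTypeIDecay C v) ∧ ¬ (∀ t < 0, v t =ᵐ[volume] 0)) :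
    ∀ (C₀ cmin cmax δ : ℝ) (L : ℕ → ℕ) (ε c : ℕ → ℝ) (R : ℕ → (ℝ³ ≃ₗᵢ[ℝ] ℝ³))
      (u : ℕ → ℝ → ℝ³ → ℝ³) (p : ℕ → ℝ → ℝ³ → ℝ) (d : ℕ → ℝ → ℝ³ → ℝ³),
      IsWindowSequence C₀ cmin cmax δ L ε c R u p d →
        ¬ ∃ A : ℝ³ ≃ₗᵢ[ℝ] ℝ³, ∀ n, ∀ t < 0, IsAxisymmetric (fun x => A.symm (u n t (A x))) := by
  intro C₀ cmin cmax δ L ε c R u p d hseq ⟨A, hax⟩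
  obtain ⟨φ, c', R', v, q, hlim⟩ := h1 C₀ cmin cmax δ L ε c R u p d hseq
  obtain ⟨hc', hmild, hmeas, hdss, hdec, hnz⟩ := h2 C₀ cmin cmax δ L ε c R u p d φ c' R' v q hseq hlim
  exact Literature.Analysis.FluidPDE.not_typeI_rdss_profile_of_isAxisymmetric_conj
    ⟨c', R', v, hc', hmild, hmeas, hdss, hdec, hnz, A, isAxisymmetric_conj_of_isLadderLimit hlim A hax⟩

end Summit.NavierStokesRegularity.NavierStokesRegularity.Cruxes.LimitTransfer.AxisymExclusion
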